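import Literature.NumberTheory.GelbartRogawski1991.LocalDoubledUnitaryDatum
import Literature.NumberTheory.Automorphic.IdeleClassCharacterAutConjSelfDual
import Literature.NumberTheory.Automorphic.Liu2021.Thm418ValueField
import HarnessLib

/-!
# The Siegel-parabolic scalar `χ(det_Δ p) |det_Δ p|^{1/2}` of the `μ`-normalised Weil representation is fixed by
# every automorphism of `ℂ` over Liu's field of values `M_μ`

Topic `NumberTheory/GelbartRogawski1991`; namespaces `Literature.NumberTheory.Automorphic.IdeleClassGroup` (§1) and
`Literature.NumberTheory.GelbartRogawski1991.UnitaryDualPair.LocalSplitting` (§2).  KERNEL ONLY: theorems; no definition,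
no named fact, no `sorry`.

Cell `hodgecm-mathlib`, row III-11 road (ε-rigidity under Galois twist), piece **P3b (i)** «σ-STABILITY OF THE
NORMALISATION» (A-p19 seam rulings R3): the local splitting of record `s_v = s(μ, a)_v : U(J)(F_v) → S̃p_ψ(𝕎_v)` is the
undoubling of Kudla's `P_Δ`-normalised splitting of the doubled group, which is PINNED by its Siegel-parabolic scalar
([Kudla1994, Thm. 3.1], [HarrisKudlaSweet1996, §1 (1.15)–(1.16)], tree `localSplittingDatumCM_parabolic`):

  `c_v(p) = ∏_{w ∣ v} χ_w(det_Δ p_w) · ∏_{w ∣ v} ‖det_Δ p_w‖_w^{1/2}`,   `χ = μ` read as a Hecke character of `E`.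

Under the Galois twist `τ = σ ∈ Aut(ℂ)` of the Schrödinger model (`HeisenbergGroup/SchrodingerGaloisTwist`,
`MpPsi.toRep_galTwist_schwartzGalConj`) the value-at-the-origin scalar of a Siegel implementer goes to `σ(c_v(p))`; so
the rigidity of the normalised splitting (`eq_of_parabolic_toRep_conj_eq`) identifies the twisted splitting with the
`μ`-splitting of the twisted data exactly when `σ(c_v(p)) = c_v(p)`.  THIS FILE proves that identity for every
`σ ∈ Aut(ℂ/M_μ)` — Liu's «Since `Gal(ℂ/M_μ)` stabilizes `μ`» ([Liu2021] proof of Thm. 4.18 (3), l. 2272) made honest: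
`c_v(p) = μ[x] · ‖x‖^{1/2} = μ^{alg}(x) · ‖x‖` for the finite idèle `x = (det_Δ p_w)_{w∣v}`, a value of `μ^{alg}` (in
`M_μ` by definition, [Liu2021] §4.1 l. 1928) times a RATIONAL number (`‖⟨u⟩_w‖ = N(w)^{−v(u)}`) — the weight-one
integrality `1/2 + 1/2 = 1`; for the bare unitary `μ` it would be false.

## Main statements

* `IdeleClassGroup.ringEquiv_apply_coe_mk_mul_sqrt_ideleNorm` — `σ(μ[x]·‖x‖^{1/2}) = μ[x]·‖x‖^{1/2}` for a finite
  idèle `x` with `σ(‖x‖) = ‖x‖` and `σ` fixing `M_μ` pointwise.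
* `IdeleClassGroup.ringEquiv_apply_coe_mk_mul_sqrt_ideleNorm_prod_localUnits` — the same for `x = ∏ᵢ ⟨uᵢ⟩_{wᵢ}`
  (no norm hypothesis: `‖⟨u⟩_w‖ ∈ ℚ`).
* `ringEquiv_parabolicScalar_eq` — **`σ(c_v(p)) = c_v(p)`** for the scalar of `localSplittingDatumCM_parabolic` at
  `χ := toHeckeCharacter E μ`, every `p ∈ H(F_v)` (off `P_Δ` the scalar is still defined, and the identity still holds).

## References

* [Liu2021] Y. Liu, *Fourier–Jacobi cycles and arithmetic relative trace formula*, Camb. J. Math. 9 (2021), §4.1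
  l. 1922–1928 (`μ^{alg}`, `M_μ`), proof of Thm. 4.18 (3) l. 2272 («`Gal(ℂ/M_μ)` stabilizes `μ`»).
* [Kudla1994] S. Kudla, Israel J. Math. 87 (1994), §3 Thm. 3.1.  [HarrisKudlaSweet1996] M. Harris, S. Kudla,
  W. Sweet, J. AMS 9 (1996), §1 (1.15)–(1.16) (the Siegel-parabolic scalar `χ(det a)|det a|^{m/2}`).
* [CasselsFrohlichANT1967] Ch. II §16 (local components of the idèle norm).
-/

set_option autoImplicit false

noncomputable section

open NumberField IsDedekindDomain
open Literature.NumberTheory.GaloisRepresentations (ideleGroup localUnits)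

/-! ## §1 `σ(μ[x] · ‖x‖^{1/2}) = μ[x] · ‖x‖^{1/2}` for `σ ∈ Aut(ℂ/M_μ)` and finite idèles `x` of rational norm -/

namespace Literature.NumberTheory.Automorphic

namespace IdeleClassGroup

variable {L : Type} [Field L] [NumberField L]

/-- **`σ(μ[x]·‖x‖^{1/2}) = μ[x]·‖x‖^{1/2}`** for `σ ∈ Aut(ℂ)` fixing Liu's field of values `M_μ` pointwise, `x` a FINITE
idèle (`x_∞ = 1`) whose norm `‖x‖ ∈ ℝ ⊂ ℂ` is fixed by `σ`: `μ[x]·‖x‖^{1/2} = μ^{alg}(x)·‖x‖`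
(`coe_apply_mk_eq_muAlg_mul_sqrt`) with `μ^{alg}(x) ∈ M_μ` (`coe_muAlg_mem_muAlgValueField`). Liu's «Since `Gal(ℂ/M_μ)`
stabilizes `μ`». [cite: Liu2021, §4.1 l. 1922–1928; proof of Thm. 4.18 (3) l. 2272] -/
theorem ringEquiv_apply_coe_mk_mul_sqrt_ideleNorm (ψ : IdeleClassGroup L →ₜ* Circle) (σ : ℂ ≃+* ℂ)
    (hσ : ∀ z ∈ Liu2021.fieldOfValues L ψ, σ z = z) {x : ideleGroup L} (hx : (x : AdeleRing (𝓞 L) L).1 = 1)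
    (hn : σ ((GaloisRepresentations.ideleNorm x : ℝ) : ℂ) = ((GaloisRepresentations.ideleNorm x : ℝ) : ℂ)) :
    σ (((ψ (x : IdeleClassGroup L) : Circle) : ℂ) * ((Real.sqrt (GaloisRepresentations.ideleNorm x) : ℝ) : ℂ)) =
      ((ψ (x : IdeleClassGroup L) : Circle) : ℂ) * ((Real.sqrt (GaloisRepresentations.ideleNorm x) : ℝ) : ℂ) := by
  have hnn : 0 ≤ GaloisRepresentations.ideleNorm x := by
    rw [← coe_ideleNorm]; exact NNReal.coe_nonneg _
  have hsq : ((Real.sqrt (GaloisRepresentations.ideleNorm x) : ℝ) : ℂ) * ((Real.sqrt (GaloisRepresentations.ideleNorm x) : ℝ) : ℂ) =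
      ((GaloisRepresentations.ideleNorm x : ℝ) : ℂ) := by
    rw [← Complex.ofReal_mul, Real.mul_self_sqrt hnn]
  have hmem : ((muAlg L ψ x : ℂˣ) : ℂ) ∈ Liu2021.fieldOfValues L ψ :=
    (Liu2021.mem_fieldOfValues_iff L ψ _).mpr (coe_muAlg_mem_muAlgValueField L ψ hx)
  rw [coe_apply_mk_eq_muAlg_mul_sqrt, mul_assoc, hsq, map_mul, hσ _ hmem, hn]

/-- The idèle norm of a finite product of local idèles `⟨uᵢ⟩_{wᵢ}` is fixed by every automorphism of `ℂ` (each factor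
`‖⟨u⟩_w‖ = ‖u‖_w = N(w)^{−v(u)}` is rational, `map_ideleNorm_localUnits`). [cite: CasselsFrohlichANT1967, Ch. II §16] -/
theorem map_ideleNorm_prod_localUnits (σ : ℂ ≃+* ℂ) {ι : Type} (s : Finset ι)
    (w : ι → HeightOneSpectrum (𝓞 L)) (u : ∀ i, ((w i).adicCompletion L)ˣ) :
    σ ((GaloisRepresentations.ideleNorm (∏ i ∈ s, localUnits (w i) (u i)) : ℝ) : ℂ) =
      ((GaloisRepresentations.ideleNorm (∏ i ∈ s, localUnits (w i) (u i)) : ℝ) : ℂ) := by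
  rw [← coe_ideleNorm, map_prod, NNReal.coe_prod, Complex.ofReal_prod, map_prod]
  refine Finset.prod_congr rfl fun i _ => ?_
  rw [coe_ideleNorm]
  exact map_ideleNorm_localUnits σ (w i) (u i)

/-- A finite product of local idèles `⟨uᵢ⟩_{wᵢ}` is a finite idèle (`x_∞ = 1`). [cite: CasselsFrohlichANT1967, Ch. II §16] -/
theorem prod_localUnits_fst {ι : Type} (s : Finset ι) (w : ι → HeightOneSpectrum (𝓞 L))
    (u : ∀ i, ((w i).adicCompletion L)ˣ) :
    ((∏ i ∈ s, localUnits (w i) (u i) : ideleGroup L) : AdeleRing (𝓞 L) L).1 = 1 := by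
  refine Finset.prod_induction (fun i => localUnits (w i) (u i))
    (fun x : ideleGroup L => (x : AdeleRing (𝓞 L) L).1 = 1) ?_ rfl ?_
  · intro a b ha hb
    change (a : AdeleRing (𝓞 L) L).1 * (b : AdeleRing (𝓞 L) L).1 = 1
    rw [ha, hb, one_mul]
  · intro i _
    exact GaloisRepresentations.localUnits_fst (w i) (u i)

/-- **`σ(μ[x]·‖x‖^{1/2}) = μ[x]·‖x‖^{1/2}` for `x = ∏ᵢ ⟨uᵢ⟩_{wᵢ}`** a finite product of local idèles and `σ ∈ Aut(ℂ/M_μ)`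
(no norm hypothesis). [cite: Liu2021, §4.1 l. 1922–1928; proof of Thm. 4.18 (3) l. 2272] -/
theorem ringEquiv_apply_coe_mk_mul_sqrt_ideleNorm_prod_localUnits (ψ : IdeleClassGroup L →ₜ* Circle) (σ : ℂ ≃+* ℂ)
    (hσ : ∀ z ∈ Liu2021.fieldOfValues L ψ, σ z = z) {ι : Type} (s : Finset ι)
    (w : ι → HeightOneSpectrum (𝓞 L)) (u : ∀ i, ((w i).adicCompletion L)ˣ) :
    σ (((ψ ((∏ i ∈ s, localUnits (w i) (u i) : ideleGroup L) : IdeleClassGroup L) : Circle) : ℂ) *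
        ((Real.sqrt (GaloisRepresentations.ideleNorm (∏ i ∈ s, localUnits (w i) (u i))) : ℝ) : ℂ)) =
      ((ψ ((∏ i ∈ s, localUnits (w i) (u i) : ideleGroup L) : IdeleClassGroup L) : Circle) : ℂ) *
        ((Real.sqrt (GaloisRepresentations.ideleNorm (∏ i ∈ s, localUnits (w i) (u i))) : ℝ) : ℂ) :=
  ringEquiv_apply_coe_mk_mul_sqrt_ideleNorm ψ σ hσ (prod_localUnits_fst s w u) (map_ideleNorm_prod_localUnits σ s w u)

end IdeleClassGroup

end Literature.NumberTheory.Automorphic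

/-! ## §2 The Siegel-parabolic scalar of the `μ`-normalised doubled Weil representation is `Aut(ℂ/M_μ)`-fixed -/

namespace Literature.NumberTheory.GelbartRogawski1991.UnitaryDualPair.LocalSplitting

open Literature.NumberTheory.Automorphic Literature.NumberTheory.Automorphic.UnitaryGroup
open Literature.NumberTheory.Automorphic.IdeleClassGroup

variable (F : Type) [Field F] [NumberField F] (E : Type) [Field E] [NumberField E] [Algebra F E]
  (c : E ≃ₐ[F] E) (v : HeightOneSpectrum (𝓞 F)) (n : ℕ)
  {JD : Matrix (Fin (n + n)) (Fin (n + n)) E}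

/-- **The parabolic scalar, unit case, as `μ[x]·‖x‖^{1/2}`**: if every `det_Δ p_w` (`w ∣ v`) is a unit, then for
`χ := μ` (as a Hecke character) `(∏_w χ_w(det_Δ p_w)⁻¹)⁻¹ · ∏_w ‖det_Δ p_w‖^{1/2} = μ[x] · ‖x‖^{1/2}` with the finite idèle
`x = ∏_{w ∣ v} ⟨det_Δ p_w⟩_w` (local components `χ_w = χ ∘ ⟨·⟩_w`, `‖⟨u⟩_w‖ = ‖u‖_w`). [cite: HarrisKudlaSweet1996, §1 (1.15)–(1.16)] [cite: CasselsFrohlichANT1967, Ch. II §16] -/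
theorem parabolicScalar_eq_coe_mk_mul_sqrt_ideleNorm (ψ : IdeleClassGroup E →ₜ* Circle)
    (p : UnitaryGroup.localPi E c (n + n) JD v)
    (hu : ∀ w : UnitaryGroup.PlacesOver E v, IsUnit (detDelta F E c v n w p)) :
    (((chiDet F E c v n (fun w' : UnitaryGroup.PlacesOver E v => ((toHeckeCharacter E ψ).localComponent w'.1)⁻¹) p)⁻¹ :
        ℂˣ) : ℂ) *
      ((∏ w' : UnitaryGroup.PlacesOver E v, Real.sqrt ‖detDelta F E c v n w' p‖ : ℝ) : ℂ) =
    ((ψ ((∏ w' : UnitaryGroup.PlacesOver E v, localUnits w'.1 (hu w').unit : ideleGroup E) : IdeleClassGroup E) : Circle) : ℂ) *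
      ((Real.sqrt (GaloisRepresentations.ideleNorm
        (∏ w' : UnitaryGroup.PlacesOver E v, localUnits w'.1 (hu w').unit)) : ℝ) : ℂ) := by
  classical
  -- the character part: `(∏_w χ_w(u_w)⁻¹)⁻¹ = χ(∏_w ⟨u_w⟩_w) = μ[x]`
  have hχ : (chiDet F E c v n (fun w' : UnitaryGroup.PlacesOver E v => ((toHeckeCharacter E ψ).localComponent w'.1)⁻¹) p)⁻¹ =
      toHeckeCharacter E ψ (∏ w' : UnitaryGroup.PlacesOver E v, localUnits w'.1 (hu w').unit) := by
    unfold chiDet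
    rw [← Finset.prod_inv_distrib, map_prod]
    refine Finset.prod_congr rfl fun w' _ => ?_
    rw [dif_pos (hu w'), MonoidHom.inv_apply, inv_inv, GaloisRepresentations.HeckeCharacter.localComponent_apply]
  -- the norm part: `∏_w ‖u_w‖^{1/2} = ‖x‖^{1/2}`
  have hnorm : (∏ w' : UnitaryGroup.PlacesOver E v, Real.sqrt ‖detDelta F E c v n w' p‖ : ℝ) =
      Real.sqrt (GaloisRepresentations.ideleNorm
        (∏ w' : UnitaryGroup.PlacesOver E v, localUnits w'.1 (hu w').unit)) := by
    rw [← coe_ideleNorm, map_prod, NNReal.coe_prod, Real.sqrt_prod _ fun w' _ => NNReal.coe_nonneg _]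
    refine Finset.prod_congr rfl fun w' _ => ?_
    rw [coe_ideleNorm, GaloisRepresentations.ideleNorm_localUnits, IsUnit.unit_spec]
  rw [hχ, hnorm, coe_toHeckeCharacter_apply]

/-- **`σ(c_v(p)) = c_v(p)` — THE SIEGEL-PARABOLIC SCALAR OF THE `μ`-NORMALISED WEIL REPRESENTATION IS FIXED BY
`Aut(ℂ/M_μ)`.**  For a unitary idèle class character `μ` of `E`, `σ ∈ Aut(ℂ)` fixing Liu's field of values
`M_μ = fieldOfValues E μ` pointwise, a finite place `v` of `F` and ANY `p ∈ H(F_v) = U(J ⊕ −J)(F_v)`: the scalar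
`(∏_{w∣v} χ_w(det_Δ p_w)⁻¹)⁻¹ · ∏_{w∣v} ‖det_Δ p_w‖_w^{1/2}` of `localSplittingDatumCM_parabolic` at
`χ := toHeckeCharacter E μ` satisfies `σ(c_v(p)) = c_v(p)`.  (On `P_Δ` every `det_Δ p_w` is a unit and
`c_v(p) = μ^{alg}(x)·‖x‖`, `x = (det_Δ p_w)_w`, `‖x‖ ∈ ℚ`; off it some `det_Δ p_w = 0` and `c_v(p) = 0`.)  This is the
σ-invariance input of the rigidity step «galTwist σ ∘ s(μ,a)_v = s(μ, κ_σ a)_v» of the III-11 road (P3b).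
[cite: Liu2021, proof of Thm. 4.18 (3) l. 2272 («Since Gal(ℂ/M_μ) stabilizes μ»); §4.1 l. 1922–1928] [cite: HarrisKudlaSweet1996, §1 (1.15)–(1.16)] [cite: Kudla1994, Thm 3.1] -/
theorem ringEquiv_parabolicScalar_eq (ψ : IdeleClassGroup E →ₜ* Circle) (σ : ℂ ≃+* ℂ)
    (hσ : ∀ z ∈ Liu2021.fieldOfValues E ψ, σ z = z) (p : UnitaryGroup.localPi E c (n + n) JD v) :
    σ ((((chiDet F E c v n (fun w' : UnitaryGroup.PlacesOver E v => ((toHeckeCharacter E ψ).localComponent w'.1)⁻¹) p)⁻¹ :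
          ℂˣ) : ℂ) *
        ((∏ w' : UnitaryGroup.PlacesOver E v, Real.sqrt ‖detDelta F E c v n w' p‖ : ℝ) : ℂ)) =
      (((chiDet F E c v n (fun w' : UnitaryGroup.PlacesOver E v => ((toHeckeCharacter E ψ).localComponent w'.1)⁻¹) p)⁻¹ :
          ℂˣ) : ℂ) *
        ((∏ w' : UnitaryGroup.PlacesOver E v, Real.sqrt ‖detDelta F E c v n w' p‖ : ℝ) : ℂ) := by
  classical
  by_cases hu : ∀ w : UnitaryGroup.PlacesOver E v, IsUnit (detDelta F E c v n w p)
  · rw [parabolicScalar_eq_coe_mk_mul_sqrt_ideleNorm F E c v n ψ p hu]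
    exact ringEquiv_apply_coe_mk_mul_sqrt_ideleNorm_prod_localUnits ψ σ hσ Finset.univ
      (fun w' : UnitaryGroup.PlacesOver E v => w'.1) (fun w' => (hu w').unit)
  · -- some `det_Δ p_w = 0`: the scalar vanishes
    obtain ⟨w₀, hw₀⟩ := not_forall.mp hu
    have h0 : detDelta F E c v n w₀ p = 0 := by rwa [isUnit_iff_ne_zero, not_not] at hw₀
    have hprod : (∏ w' : UnitaryGroup.PlacesOver E v, Real.sqrt ‖detDelta F E c v n w' p‖ : ℝ) = 0 :=
      Finset.prod_eq_zero (Finset.mem_univ w₀) (by rw [h0, norm_zero, Real.sqrt_zero])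
    rw [hprod, Complex.ofReal_zero, mul_zero, map_zero]

end Literature.NumberTheory.GelbartRogawski1991.UnitaryDualPair.LocalSplitting

end
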